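import Summits.RiemannHypothesis.RiemannHypothesis.Theorems.LiAsymptoticSmoothCutsLow
import HarnessLib

/-!
# RiemannHypothesis / LiAsymptotic — crux K2 `LiSmoothMainTerm`, stub K2c: the two CUTS of the model integral (RH-FREE)

RH-FREE [rh-li-prover].  Route `Theses/LiAsymptotic.lean` (rung L-P(P1⁺) «Li asymptotic law, quadratic range»,
cell `pub/rh-li`, theory memo `theory/TARGETS.md` §11.2 STEP 6 (6d)(6e)), item `LiSmoothMainTerm`
(stmt-RiemannHypothesis-19162), registered birth stub `stub_cuts` (K2c) VERBATIM: for `n ≥ 100`, `T' ≥ n²`,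

  `|(1/π)∫_{√n}^{T'} G − ((1/π)∫_{(0,∞)} G − 2 liCountMain √n)| ≤ 0.64 log n + 0.67`,  `G(t) = (1 − cos(n/t)) log(t/2π)`.

Proof: `G` is integrable on `(0, ∞)` (`|G| ≤ 2|log(t/2π)|` near `0`, part 1; `0 ≤ G ≤ n² log t/(2t²)` beyond `2π`,
here), so `∫_{(0,∞)} G = ∫_0^{√n} G + ∫_{√n}^{T'} G + ∫_{(T',∞)} G`; the lower cut is
`∫_0^{√n} log(t/2π) − ∫_0^{√n} cos(n/t) log(t/2π)` whose first term is EXACTLY `π · 2 liCountMain √n`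
(`= √n log(√n/2π) − √n`) and whose second is `≤ log n − log 2π + 1.7` in absolute value (part 1,
`SmoothCuts.abs_integral_low`); the upper cut is `0 ≤ ∫_{(T',∞)} G ≤ (n²/2)(log T' + 1)/T' ≤ log n + ½`
(`∫_{T'}^∞ log t/t² = (log T' + 1)/T'`, decreasing in `T' ≥ n²`).  Total `(2 log n + 0.51)/π`.
Elementary real analysis; nothing here bears on the truth of RH.
-/

noncomputable section

-- D-0017: `Summit.<S>.<S>.…` is the designed namespace of a single-problem summit.
set_option linter.dupNamespace false

open MeasureTheory intervalIntegral Set Filter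
open scoped Real Interval Topology

namespace Summit.RiemannHypothesis.RiemannHypothesis.Theorems.LiTheory

namespace SmoothCuts

/-! ### The tail majorant `log t / t²` -/

/-- `d/dt (−(log t + 1)/t) = log t/t²` (`t ≠ 0`). -/
theorem hasDerivAt_neg_logp1_div {t : ℝ} (ht : t ≠ 0) :
    HasDerivAt (fun y : ℝ ↦ -((Real.log y + 1) / y)) (Real.log t / t ^ 2) t := by
  have h1 : HasDerivAt (fun y : ℝ ↦ Real.log y + 1) t⁻¹ t := by
    simpa using (Real.hasDerivAt_log ht).add_const 1
  have h := (h1.div (hasDerivAt_id t) ht).neg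
  refine h.congr_deriv ?_
  simp only [id]
  field_simp
  ring

/-- `−(log t + 1)/t → 0`. -/
theorem tendsto_neg_logp1_div : Tendsto (fun y : ℝ ↦ -((Real.log y + 1) / y)) atTop (𝓝 0) := by
  have h1 : Tendsto (fun y : ℝ ↦ Real.log y ^ 1 / (1 * y + 0)) atTop (𝓝 0) :=
    Real.tendsto_pow_log_div_mul_add_atTop 1 0 1 one_ne_zero
  have h2 : Tendsto (fun y : ℝ ↦ y⁻¹) atTop (𝓝 0) := tendsto_inv_atTop_zero
  have h := (h1.add h2).neg
  simp only [pow_one, one_mul, add_zero, neg_zero] at h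
  refine h.congr' ?_
  filter_upwards [eventually_gt_atTop (0 : ℝ)] with y hy
  field_simp

/-- For `a ≥ 1`: `log t/t²` is integrable on `(a, ∞)` with `∫_{(a,∞)} log t/t² = (log a + 1)/a`. -/
theorem integral_log_div_sq {a : ℝ} (ha : 1 ≤ a) :
    IntegrableOn (fun t : ℝ ↦ Real.log t / t ^ 2) (Ioi a) ∧
      ∫ t in Ioi a, Real.log t / t ^ 2 = (Real.log a + 1) / a := by
  have hderiv : ∀ x ∈ Ici a, HasDerivAt (fun y : ℝ ↦ -((Real.log y + 1) / y)) (Real.log x / x ^ 2) x :=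
    fun x hx ↦ hasDerivAt_neg_logp1_div (by linarith [mem_Ici.1 hx])
  have hpos : ∀ x ∈ Ioi a, 0 ≤ Real.log x / x ^ 2 := fun x hx ↦
    div_nonneg (Real.log_nonneg (by linarith [mem_Ioi.1 hx])) (sq_nonneg _)
  refine ⟨integrableOn_Ioi_deriv_of_nonneg' hderiv hpos tendsto_neg_logp1_div, ?_⟩
  rw [integral_Ioi_of_hasDerivAt_of_nonneg' hderiv hpos tendsto_neg_logp1_div]
  ring

/-! ### `G` beyond `2π` -/

/-- `0 ≤ 1 − cos(n/t) ≤ n²/(2t²)`. -/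
theorem one_sub_cos_mem (n : ℕ) {t : ℝ} (ht : t ≠ 0) :
    0 ≤ 1 - Real.cos (n / t) ∧ 1 - Real.cos (n / t) ≤ (n : ℝ) ^ 2 / (2 * t ^ 2) := by
  refine ⟨by linarith [Real.cos_le_one (n / t)], ?_⟩
  have h := Real.one_sub_sq_div_two_le_cos (x := n / t)
  have e : ((n : ℝ) / t) ^ 2 / 2 = (n : ℝ) ^ 2 / (2 * t ^ 2) := by field_simp
  linarith

/-- For `t ≥ 2π`: `0 ≤ G(t) ≤ (n²/2) · log t/t²`. -/
theorem G_mem (n : ℕ) {t : ℝ} (ht : 2 * π ≤ t) :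
    0 ≤ (1 - Real.cos (n / t)) * Real.log (t / (2 * π)) ∧
      (1 - Real.cos (n / t)) * Real.log (t / (2 * π)) ≤ (n : ℝ) ^ 2 / 2 * (Real.log t / t ^ 2) := by
  have hπ3 := Real.pi_gt_three
  have ht0 : 0 < t := by linarith
  obtain ⟨hg0, hg⟩ := one_sub_cos_mem n ht0.ne'
  have hℓ0 : 0 ≤ Real.log (t / (2 * π)) := Real.log_nonneg (by rw [le_div_iff₀ (by positivity)]; linarith)
  have hℓ : Real.log (t / (2 * π)) ≤ Real.log t := by
    rw [ell_eq ht0.ne']; linarith [log_two_pi_mem.1]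
  refine ⟨mul_nonneg hg0 hℓ0, ?_⟩
  calc (1 - Real.cos (n / t)) * Real.log (t / (2 * π)) ≤ (n : ℝ) ^ 2 / (2 * t ^ 2) * Real.log t :=
        mul_le_mul hg hℓ hℓ0 (by positivity)
    _ = (n : ℝ) ^ 2 / 2 * (Real.log t / t ^ 2) := by field_simp

/-- `G` is continuous on `(0, ∞)`. -/
theorem continuousOn_G (n : ℕ) : ContinuousOn (fun t : ℝ ↦ (1 - Real.cos (n / t)) * Real.log (t / (2 * π))) (Ioi 0) := by
  refine continuousOn_of_forall_continuousAt fun t ht ↦ ?_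
  have h1 : t ≠ 0 := (mem_Ioi.1 ht).ne'
  have h2 : t / (2 * π) ≠ 0 := by have := mem_Ioi.1 ht; positivity
  fun_prop (disch := assumption)

/-- For `a ≥ 2π`: `G` is integrable on `(a, ∞)`, with `0 ≤ ∫_{(a,∞)} G ≤ (n²/2)(log a + 1)/a`. -/
theorem integral_G_Ioi {n : ℕ} {a : ℝ} (ha : 2 * π ≤ a) :
    IntegrableOn (fun t : ℝ ↦ (1 - Real.cos (n / t)) * Real.log (t / (2 * π))) (Ioi a) ∧
      0 ≤ ∫ t in Ioi a, (1 - Real.cos (n / t)) * Real.log (t / (2 * π)) ∧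
      ∫ t in Ioi a, (1 - Real.cos (n / t)) * Real.log (t / (2 * π)) ≤ (n : ℝ) ^ 2 / 2 * ((Real.log a + 1) / a) := by
  have hπ3 := Real.pi_gt_three
  have ha1 : 1 ≤ a := by linarith
  have ha0 : 0 < a := by linarith
  obtain ⟨hHint, hHval⟩ := integral_log_div_sq ha1
  have hHint' : IntegrableOn (fun t : ℝ ↦ (n : ℝ) ^ 2 / 2 * (Real.log t / t ^ 2)) (Ioi a) := hHint.const_mul _
  have hmeas : AEStronglyMeasurable (fun t : ℝ ↦ (1 - Real.cos (n / t)) * Real.log (t / (2 * π)))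
      (volume.restrict (Ioi a)) :=
    ((continuousOn_G n).mono (Ioi_subset_Ioi ha0.le)).aestronglyMeasurable measurableSet_Ioi
  have hGint : IntegrableOn (fun t : ℝ ↦ (1 - Real.cos (n / t)) * Real.log (t / (2 * π))) (Ioi a) := by
    refine Integrable.mono' hHint' hmeas ?_
    filter_upwards [ae_restrict_mem measurableSet_Ioi] with t ht
    obtain ⟨h0, h1⟩ := G_mem n (ha.trans (mem_Ioi.1 ht).le)
    rw [Real.norm_eq_abs, abs_of_nonneg h0]; exact h1
  refine ⟨hGint, setIntegral_nonneg measurableSet_Ioi fun t ht ↦ (G_mem n (ha.trans (mem_Ioi.1 ht).le)).1, ?_⟩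
  calc ∫ t in Ioi a, (1 - Real.cos (n / t)) * Real.log (t / (2 * π))
      ≤ ∫ t in Ioi a, (n : ℝ) ^ 2 / 2 * (Real.log t / t ^ 2) :=
        setIntegral_mono_on hGint hHint' measurableSet_Ioi fun t ht ↦ (G_mem n (ha.trans (mem_Ioi.1 ht).le)).2
    _ = (n : ℝ) ^ 2 / 2 * ((Real.log a + 1) / a) := by rw [MeasureTheory.integral_const_mul, hHval]

/-- `G` is integrable on `(0, ∞)`. -/
theorem integrableOn_G_Ioi_zero (n : ℕ) :
    IntegrableOn (fun t : ℝ ↦ (1 - Real.cos (n / t)) * Real.log (t / (2 * π))) (Ioi 0) := by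
  have h2π : (0 : ℝ) ≤ 2 * π := by positivity
  have h1 : IntegrableOn (fun t : ℝ ↦ (1 - Real.cos (n / t)) * Real.log (t / (2 * π))) (Ioc 0 (2 * π)) :=
    (intervalIntegrable_iff_integrableOn_Ioc_of_le h2π).1 (intervalIntegrable_G n h2π)
  have h2 := (integral_G_Ioi (n := n) (le_refl (2 * π))).1
  rw [← Ioc_union_Ioi_eq_Ioi h2π]
  exact h1.union h2

/-- Splitting `∫_{(0,∞)} G` at `0 < a ≤ T'`. -/
theorem integral_G_split (n : ℕ) {a T' : ℝ} (ha : 0 < a) (haT : a ≤ T') :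
    ∫ t in Ioi 0, (1 - Real.cos (n / t)) * Real.log (t / (2 * π)) =
      (∫ t in (0 : ℝ)..a, (1 - Real.cos (n / t)) * Real.log (t / (2 * π))) +
        (∫ t in a..T', (1 - Real.cos (n / t)) * Real.log (t / (2 * π))) +
        ∫ t in Ioi T', (1 - Real.cos (n / t)) * Real.log (t / (2 * π)) := by
  set G : ℝ → ℝ := fun t ↦ (1 - Real.cos (n / t)) * Real.log (t / (2 * π)) with hG
  have hT0 : 0 ≤ T' := ha.le.trans haT
  have hall := integrableOn_G_Ioi_zero n
  have hIoc : IntegrableOn G (Ioc 0 T') := hall.mono_set Ioc_subset_Ioi_self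
  have hIoi : IntegrableOn G (Ioi T') := hall.mono_set (Ioi_subset_Ioi hT0)
  have hdisj : Disjoint (Ioc (0 : ℝ) T') (Ioi T') := by
    rw [Set.disjoint_left]; intro t ht ht'; exact absurd (mem_Ioi.1 ht') (not_lt.2 ht.2)
  rw [← Ioc_union_Ioi_eq_Ioi hT0, setIntegral_union hdisj measurableSet_Ioi hIoc hIoi,
    ← intervalIntegral.integral_of_le hT0]
  have i0T : IntervalIntegrable G volume 0 T' := (intervalIntegrable_iff_integrableOn_Ioc_of_le hT0).2 hIoc
  have i0a : IntervalIntegrable G volume 0 a := intervalIntegrable_G n ha.le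
  have iaT : IntervalIntegrable G volume a T' := i0a.symm.trans i0T
  rw [← intervalIntegral.integral_add_adjacent_intervals i0a iaT]

/-- `(log y + 1)/y ≤ (log x + 1)/x` for `e ≤ x ≤ y`. -/
theorem logp1_div_antitone {x y : ℝ} (hx : Real.exp 1 ≤ x) (hxy : x ≤ y) :
    (Real.log y + 1) / y ≤ (Real.log x + 1) / x := by
  have hx0 : 0 < x := (Real.exp_pos 1).trans_le hx
  have h1 : Real.log y / y ≤ Real.log x / x :=
    Real.log_div_self_antitoneOn (Set.mem_Ici.2 hx) (Set.mem_Ici.2 (hx.trans hxy)) hxy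
  have h2 : 1 / y ≤ 1 / x := one_div_le_one_div_of_le hx0 hxy
  rw [add_div, add_div]
  linarith

end SmoothCuts

open SmoothCuts in
/-- **Stub K2c `stub_cuts` of crux `LiSmoothMainTerm`** (route `LiAsymptotic`, stmt-RiemannHypothesis-19162; RH-FREE):
for `n ≥ 100`, `T' ≥ n²`, with `G(t) = (1 − cos(n/t)) log(t/2π)`,
`|(1/π)∫_{√n}^{T'} G − ((1/π)∫_{(0,∞)} G − 2 liCountMain √n)| ≤ 0.64 log n + 0.67`.  Verbatim the registered signature
`Sig.stub_cuts`. -/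
theorem liSmoothCuts_bound :
    ∀ (n : ℕ) (T' : ℝ), 100 ≤ n → (n : ℝ) ^ 2 ≤ T' →
      |1 / Real.pi * (∫ t in Real.sqrt n..T', (1 - Real.cos (n / t)) * Real.log (t / (2 * Real.pi))) -
        (1 / Real.pi * (∫ t in Set.Ioi (0 : ℝ), (1 - Real.cos (n / t)) * Real.log (t / (2 * Real.pi))) -
          2 * liCountMain (Real.sqrt n))| ≤ 0.64 * Real.log n + 0.67 := by
  intro n T' hn hT'
  have hπ := Real.pi_pos
  have hπ3 := Real.pi_gt_d4
  have hπ4 := Real.pi_lt_d2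
  obtain ⟨hℓlo, hℓhi⟩ := log_two_pi_mem
  have hnR : (100 : ℝ) ≤ n := by exact_mod_cast hn
  have hn1 : 1 ≤ n := le_trans (by norm_num) hn
  have hn0 : (0 : ℝ) ≤ n := by positivity
  set a := Real.sqrt n with ha
  have haa : a ^ 2 = n := by rw [ha, Real.sq_sqrt hn0]
  have ha10 : 10 ≤ a := by
    have h10 : Real.sqrt ((10 : ℝ) ^ 2) = 10 := Real.sqrt_sq (by norm_num)
    rw [ha, ← h10]
    exact Real.sqrt_le_sqrt (by linarith)
  have ha0 : 0 < a := by linarith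
  have ha2π : 2 * π ≤ a := by linarith
  have haT : a ≤ T' := by nlinarith
  have hloga : Real.log a = Real.log n / 2 := by rw [ha, Real.log_sqrt hn0]
  set G : ℝ → ℝ := fun t ↦ (1 - Real.cos (n / t)) * Real.log (t / (2 * π)) with hG
  -- split the half-line integral
  have hsplit := integral_G_split n ha0 haT
  -- the lower cut: `∫_0^a G = ∫_0^a ℓ − ∫_0^a cos ℓ`
  have hlow : ∫ t in (0 : ℝ)..a, G t = (a * Real.log (a / (2 * π)) - a) -
      ∫ t in (0 : ℝ)..a, Real.cos (n / t) * Real.log (t / (2 * π)) := by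
    rw [← integral_ell ha0, ← intervalIntegral.integral_sub (intervalIntegrable_ell a ha0.le)
      (intervalIntegrable_cos_mul_ell n ha0.le)]
    refine intervalIntegral.integral_congr fun t _ ↦ ?_
    simp only [hG]; ring
  -- `2 liCountMain a = (1/π)(a log(a/2π) − a)`
  have hL : 2 * liCountMain a = 1 / π * (a * Real.log (a / (2 * π)) - a) := by
    unfold liCountMain
    have : Real.log (a / (2 * π * Real.exp 1)) = Real.log (a / (2 * π)) - 1 := by
      rw [Real.log_div ha0.ne' (by positivity), Real.log_mul (by positivity) (Real.exp_pos 1).ne', Real.log_exp,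
        Real.log_div ha0.ne' (by positivity)]
      ring
    rw [this]; field_simp
  -- reduce to the two cut pieces
  set Ilow := ∫ t in (0 : ℝ)..a, Real.cos (n / t) * Real.log (t / (2 * π)) with hIlow
  set Itail := ∫ t in Ioi T', G t with hItail
  have hD : 1 / π * (∫ t in a..T', G t) - (1 / π * (∫ t in Ioi (0 : ℝ), G t) - 2 * liCountMain a) =
      1 / π * (Ilow - Itail) := by
    rw [hsplit, hlow, hL]; ring
  rw [hD, abs_mul, abs_of_pos (by positivity : (0 : ℝ) < 1 / π)]
  -- the bounds
  have hIlow_le := abs_integral_low hn1 ha2π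
  rw [← hIlow, haa] at hIlow_le
  obtain ⟨-, htail0, htail⟩ := integral_G_Ioi (n := n) (a := T') (ha2π.trans haT)
  rw [← hItail] at htail0 htail
  have he : Real.exp 1 ≤ (n : ℝ) ^ 2 := by have := Real.exp_one_lt_d9; nlinarith
  have htail' : Itail ≤ Real.log n + 1 / 2 := by
    have h1 := logp1_div_antitone he hT'
    have h2 : (n : ℝ) ^ 2 / 2 * ((Real.log ((n : ℝ) ^ 2) + 1) / (n : ℝ) ^ 2) = Real.log n + 1 / 2 := by
      rw [Real.log_pow]; field_simp; ring
    have h3 : (n : ℝ) ^ 2 / 2 * ((Real.log T' + 1) / T') ≤ (n : ℝ) ^ 2 / 2 * ((Real.log ((n : ℝ) ^ 2) + 1) / (n : ℝ) ^ 2) :=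
      mul_le_mul_of_nonneg_left h1 (by positivity)
    linarith
  have hlogn : 0 ≤ Real.log n := Real.log_nonneg (by linarith)
  have hℓa : Real.log (a / (2 * π)) = Real.log n / 2 - Real.log (2 * π) := by rw [ell_eq ha0.ne', hloga]
  rw [hℓa] at hIlow_le
  have hnn : (n : ℝ) ≠ 0 := by positivity
  have hn' : (2 * ((n : ℝ) * (Real.log n / 2 - Real.log (2 * π))) + 70) / n =
      Real.log n - 2 * Real.log (2 * π) + 70 / n := by
    field_simp
    try ring
  rw [hn'] at hIlow_le
  have h70 : (70 : ℝ) / n ≤ 0.7 := by rw [div_le_iff₀ (by positivity)]; linarith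
  have htot : |Ilow - Itail| ≤ 2 * Real.log n + 0.507 := by
    calc |Ilow - Itail| ≤ |Ilow| + |Itail| := abs_sub _ _
      _ ≤ (Real.log (2 * π) + 1 + (Real.log n - 2 * Real.log (2 * π) + 70 / n)) + (Real.log n + 1 / 2) := by
          rw [abs_of_nonneg htail0]; exact add_le_add hIlow_le htail'
      _ ≤ 2 * Real.log n + 0.507 := by linarith
  calc 1 / π * |Ilow - Itail| ≤ 1 / π * (2 * Real.log n + 0.507) := mul_le_mul_of_nonneg_left htot (by positivity)
    _ ≤ 0.64 * Real.log n + 0.67 := by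
        rw [div_mul_eq_mul_div, one_mul, div_le_iff₀ hπ]; nlinarith

end Summit.RiemannHypothesis.RiemannHypothesis.Theorems.LiTheory

end
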